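import Literature.AlgebraicGeometry.Motives.WeilJacobianSymmetrize
import HarnessLib

/-!
# Weil's construction of the Jacobian, III: the group law; `J` is an abelian variety

Continuing `Motives/WeilJacobianGlue` and `Motives/WeilJacobianSymmetrize` (Milne, *Jacobian
Varieties*, §7, proof of Thm. 7.1), we put the group law on the glued `K`-scheme `J` and obtain
Weil's Jacobian `WeilJacobian.Jac C … : AbelianVariety K` (for `K = K̄` of characteristic `0`, `C`
a smooth projective geometrically integral curve, `genus ≤ g`, `W ≠ ∅`).

* `WeilJacobian.cls : J(K) → Pic(C)`, `[E − Σ[R]] ↦ [Ê(E) − Σ[R]]`, is well defined and INJECTIVE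
  (`cls_comp_chart`, `cls_injective`, from `comp_chart_eq_iff`).
* ADDITION. For charts `(R₁, R₂, R₃)` the open piece `A ⊆ W ×_K W` of pairs `(E, F)` with
  `ℓ(Ê(E) + Ê(F) − Σ[R₁] − Σ[R₂] + Σ[R₃]) ≤ 1` (semicontinuity on `C⁽ᵍ⁾ × C⁽ᵍ⁾`,
  `exists_opens_tensor_symPowProj_pt_mem_iff`) carries the MORPHISM
  `(E, F) ↦ E₃ ∼ E + F − Σ[R₁] − Σ[R₂] + Σ[R₃]` into `W` (`addPK`, the master theorem
  `exists_hom_add`), hence `addJ : A → J` through the chart `R₃`, with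
  `cls ∘ addJ = cls [E − Σ[R₁]] + cls [F − Σ[R₂]]` (`cls_comp_addJ`). Through the charts the
  pieces form an open cover of `J ×_K J` (`addCover`: they contain all `K`-points, `J ×_K J` is
  Jacobson), the `addJ` agree on overlaps (`addJ_compat`: compare `cls`), and glue to
  `WeilJacobian.mK : J ×_K J → J` with `cls (z₁ + z₂) = cls z₁ + cls z₂` (`cls_mul`).
* INVERSION. Likewise with the pieces `I_{R,R'} ⊆ W`, `ℓ(−Ê(E) + Σ[R] + Σ[R']) ≤ 1`, the morphisms
  `E ↦ E' ∼ −E + Σ[R] + Σ[R']` (`invPK`, the master theorem `exists_hom_reflect`) and the charts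
  `R'`: `WeilJacobian.invK : J → J` with `cls (inv z) = −cls z` (`cls_inv`).
* UNIT. `WeilJacobian.oneK : Spec K → J` is `[E₀ − Ê(E₀)]` for a `K`-point `E₀` of `W`, `cls = 0`.
* By `GrpObj.ofAlgPointsOfInjective` (`Motives/GrpObjOfAlgPoints`: a group-scheme structure is
  detected on `K`-points of a geometrically integral separated `K`-scheme of finite type) these
  make `J` a group scheme (`WeilJacobian.grpObj`); with `J` proper and geometrically integral
  (`Motives/WeilJacobianSymmetrize`) this is the abelian variety `WeilJacobian.Jac`.

The identification `dim J = g`, the map `C → J` and the comparison with the tree's `Jacobian C`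
(universal property) follow in `Motives/JacobianDimensionWeil`.

Mathlib searched (pin): `CartesianMonoidalCategory.lift_map`, `tensorHom_fst`, `tensorHom_snd`,
`Over.OverMorphism.ext`, `Over.isoMk`, `QuotientAddGroup.mk_neg`, `Scheme.Cover.glueMorphisms`
(all used); no Jacobians / Picard schemes in Mathlib.

## References

* J. S. Milne, *Jacobian Varieties*, in Cornell–Silverman (eds.), *Arithmetic Geometry* (1986),
  §7 Thm. 7.1 (Weil's construction of the Jacobian). [Milne1986JacobianVarieties]
* A. Weil, *Variétés abéliennes et courbes algébriques*, Hermann (1948). [Weil1948VarietesAbeliennes]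
-/

noncomputable section

universe u

open CategoryTheory CategoryTheory.Limits AlgebraicGeometry MonoidalCategory CartesianMonoidalCategory
  TopologicalSpace
open Literature.NumberTheory.DiophantineGeometry
open Literature.NumberTheory.DiophantineGeometry.AlgFunctionField
open Literature.AlgebraicGeometry.RelativeSpec

namespace Literature.AlgebraicGeometry.Motives

open RatFn FieldPoint CartierDivisor CurvePlaces

/-! ### Tensor products of open immersions -/

section TensorOpenImm

variable {K : Type u} [Field K]

/-- `f ⊗ g` is an open immersion when `f` and `g` are. [folklore] -/
theorem isOpenImmersion_tensorHom_left {X X' Y Y' : SchemeOver K} (f : X ⟶ X') (g : Y ⟶ Y')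
    [IsOpenImmersion f.left] [IsOpenImmersion g.left] : IsOpenImmersion (f ⊗ₘ g).left := by
  rw [tensorHom_def, Over.comp_left]
  haveI : IsOpenImmersion (f ▷ Y).left :=
    MorphismProperty.of_isPullback (P := @IsOpenImmersion) (isPullback_whiskerRight_left' f Y).flip inferInstance
  haveI : IsOpenImmersion (X' ◁ g).left :=
    MorphismProperty.of_isPullback (P := @IsOpenImmersion)
      (Limits.SubalgApprox.isPullback_whiskerLeft_left X' g).flip inferInstance
  infer_instance

/-- Components of a `K`-point of a product. [folklore] -/
theorem AlgPoints.lift_fst_snd {X Y : SchemeOver K} (w : AlgPoints (X ⊗ Y) K) :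
    lift (w ≫ fst X Y) (w ≫ snd X Y) = w := by
  apply CartesianMonoidalCategory.hom_ext <;> simp only [lift_fst, lift_snd]

end TensorOpenImm

namespace WeilJacobian

variable {K : Type u} [Field K] [IsAlgClosed K] [CharZero K]
  (C : SchemeOver K) [IsIntegral C.left] [SmoothOfRelativeDimension 1 C.hom] [IsProper C.hom]
  [GeometricallyIntegral C.hom] (hC : IsProjectiveOver C) (hX : CechPseudoCoherentAt C) (g : ℕ)
  (hg : (genus K (curveBC C (strPt (K := K) K)).left.functionField : ℤ) ≤ g)

/-! ### The divisor class of a `K`-point of `J` -/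

/-- **The divisor class `[Ê(E) − Σ[R]] ∈ Pic(C)` of the `K`-point `[E − Σ[R]]` of `J`** (well
defined by `comp_chart_eq_iff`). [cite: Milne1986JacobianVarieties, §7 (proof of Thm. 7.1)] -/
def cls (z : AlgPoints (JK C hC hX g hg) K) : DivisorClass K (curveBC C (strPt (K := K) K)).left.functionField :=
  DivisorClass.mk (liftDiv C g hC ((exists_comp_chart_eq C hC hX g hg z).choose_spec.choose ≫ ιW C hC hX g) -
    tupleDiv C (exists_comp_chart_eq C hC hX g hg z).choose)

/-- **`cls [E − Σ[R]] = [Ê(E) − Σ[R]]`.** [folklore] -/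
theorem cls_comp_chart (R : Fin g → AlgPoints C K) (x : AlgPoints (WK C hC hX g) K) :
    cls C hC hX g hg (x ≫ chart C hC hX g hg R) = DivisorClass.mk (liftDiv C g hC (x ≫ ιW C hC hX g) - tupleDiv C R) := by
  rw [cls, DivisorClass.mk_eq_mk_iff]
  exact (comp_chart_eq_iff C hC hX g hg _ R _ x).mp
    (exists_comp_chart_eq C hC hX g hg (x ≫ chart C hC hX g hg R)).choose_spec.choose_spec

/-- **`cls` is injective on `J(K)`.** [cite: Milne1986JacobianVarieties, §7 (proof of Thm. 7.1)] -/
theorem cls_injective : Function.Injective (cls C hC hX g hg) := by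
  intro z z' h
  obtain ⟨R, x, rfl⟩ := exists_comp_chart_eq C hC hX g hg z
  obtain ⟨R', x', rfl⟩ := exists_comp_chart_eq C hC hX g hg z'
  rw [cls_comp_chart, cls_comp_chart, DivisorClass.mk_eq_mk_iff] at h
  exact (comp_chart_eq_iff C hC hX g hg R R' x x').mpr h

/-! ### The addition pieces: `(E, F) ↦ E₃ ∼ E + F − Σ[R₁] − Σ[R₂] + Σ[R₃]` -/

/-- Index of an addition piece: the three charts `(R₁, R₂, R₃)`. [folklore] -/
abbrev AddIdx : Type u := (Fin g → AlgPoints C K) × (Fin g → AlgPoints C K) × (Fin g → AlgPoints C K)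

/-- **The open `{(y₁, y₂) : ℓ(Ê(y₁) + Ê(y₂) − Σ[R₁] − Σ[R₂] + Σ[R₃]) ≤ 1}` of `C⁽ᵍ⁾ × C⁽ᵍ⁾`.** [folklore] -/
def addOpens (i : AddIdx C g) : (symPowProj C hC g ⊗ symPowProj C hC g).left.Opens :=
  opensOfAlgPoints (symPowProj C hC g ⊗ symPowProj C hC g) fun w ↦
    ell (liftDiv C g hC (w ≫ fst _ _) + liftDiv C g hC (w ≫ snd _ _) + tupleDiv C i.2.2 -
      tupleDiv C (Fin.append i.1 i.2.1)) ≤ 1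

omit [CharZero K] in
include hX in
/-- `K`-points of `addOpens i`. [folklore] -/
theorem pt_mem_addOpens_iff (i : AddIdx C g) (w : AlgPoints (symPowProj C hC g ⊗ symPowProj C hC g) K) :
    w.pt ∈ addOpens C hC g i ↔ ell (liftDiv C g hC (w ≫ fst _ _) + liftDiv C g hC (w ≫ snd _ _) + tupleDiv C i.2.2 -
      tupleDiv C (Fin.append i.1 i.2.1)) ≤ 1 := by
  haveI := symPowProj.locallyOfFiniteType_hom C hC g
  refine pt_mem_opensOfAlgPoints_iff ?_ w
  obtain ⟨U, hU⟩ := exists_opens_tensor_symPowProj_pt_mem_iff C hX g hC 1 i.2.2 (Fin.append i.1 i.2.1)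
  refine ⟨U, fun z ↦ ?_⟩
  obtain ⟨S₁, hS₁⟩ := exists_tuplePt_mk_eq C g hC (z ≫ fst _ _)
  obtain ⟨S₂, hS₂⟩ := exists_tuplePt_mk_eq C g hC (z ≫ snd _ _)
  rw [← AlgPoints.lift_fst_snd z, ← hS₁, ← hS₂, hU, lift_fst, lift_snd, liftDiv_tuplePt_mk, liftDiv_tuplePt_mk]

/-- `ιW ⊗ ιW` is an open immersion. [folklore] -/
instance isOpenImmersion_ιW_tensor_ιW_left : IsOpenImmersion (ιW C hC hX g ⊗ₘ ιW C hC hX g).left :=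
  isOpenImmersion_tensorHom_left _ _

/-- **The addition piece `A_i ⊆ W ×_K W`**: pairs `(E, F)` with
`ℓ(Ê(E) + Ê(F) − Σ[R₁] − Σ[R₂] + Σ[R₃]) ≤ 1`. [cite: Milne1986JacobianVarieties, §7 (proof of Thm. 7.1)] -/
abbrev addV (i : AddIdx C g) : (WK C hC hX g ⊗ WK C hC hX g).left.Opens :=
  (ιW C hC hX g ⊗ₘ ιW C hC hX g).left ⁻¹ᵁ addOpens C hC g i

omit [CharZero K] in
/-- `K`-points of the addition piece. [folklore] -/
theorem pt_mem_addV_iff (i : AddIdx C g) (w : AlgPoints (WK C hC hX g ⊗ WK C hC hX g) K) :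
    w.pt ∈ addV C hC hX g i ↔ ell (liftDiv C g hC ((w ≫ fst _ _) ≫ ιW C hC hX g) +
      liftDiv C g hC ((w ≫ snd _ _) ≫ ιW C hC hX g) + tupleDiv C i.2.2 - tupleDiv C (Fin.append i.1 i.2.1)) ≤ 1 := by
  show (ιW C hC hX g ⊗ₘ ιW C hC hX g).left w.pt ∈ addOpens C hC g i ↔ _
  rw [← AlgPoints.pt_comp, pt_mem_addOpens_iff C hC hX g, Category.assoc, Category.assoc, tensorHom_fst, tensorHom_snd,
    ← Category.assoc, ← Category.assoc]

omit [CharZero K] in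
include hg in
/-- On the addition piece `ℓ(…) = 1` (Riemann). [folklore] -/
theorem ell_eq_one_of_pt_mem_addV (i : AddIdx C g) (w : AlgPoints (WK C hC hX g ⊗ WK C hC hX g) K)
    (hw : w.pt ∈ addV C hC hX g i) :
    ell (liftDiv C g hC ((w ≫ fst _ _) ≫ ιW C hC hX g) + liftDiv C g hC ((w ≫ snd _ _) ≫ ιW C hC hX g) +
      tupleDiv C i.2.2 - tupleDiv C (Fin.append i.1 i.2.1)) = 1 := by
  refine le_antisymm ((pt_mem_addV_iff C hC hX g i w).mp hw) (one_le_ell_of_degree_eq C g hg ?_)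
  rw [map_sub, map_add, map_add, degree_liftDiv, degree_liftDiv, degree_tupleDiv, tupleDiv_append, map_add,
    degree_tupleDiv, degree_tupleDiv]
  ring

/-- The addition piece as a `K`-scheme. [folklore] -/
abbrev AK (i : AddIdx C g) : SchemeOver K := overMk ((addV C hC hX g i).ι ≫ (WK C hC hX g ⊗ WK C hC hX g).hom)

/-- The inclusion of the addition piece into `W ×_K W`. [folklore] -/
abbrev ιA (i : AddIdx C g) : AK C hC hX g i ⟶ WK C hC hX g ⊗ WK C hC hX g := Over.homMk (addV C hC hX g i).ι rfl

/-- `ιA` is an open immersion. [folklore] -/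
instance isOpenImmersion_ιA_left (i : AddIdx C g) : IsOpenImmersion (ιA C hC hX g i).left :=
  inferInstanceAs (IsOpenImmersion (addV C hC hX g i).ι)

/-- `W ×_K W → Spec K` is locally of finite type. [folklore] -/
instance locallyOfFiniteType_WK_tensor_hom : LocallyOfFiniteType (WK C hC hX g ⊗ WK C hC hX g).hom := inferInstance

/-- `W ×_K W` is reduced (an open of the integral `C⁽ᵍ⁾ ×_K C⁽ᵍ⁾`). [folklore] -/
instance isReduced_WK_tensor_left : IsReduced (WK C hC hX g ⊗ WK C hC hX g).left := by
  haveI := isIntegral_symPowProj_tensor_left C hC g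
  exact isReduced_of_isOpenImmersion (ιW C hC hX g ⊗ₘ ιW C hC hX g).left

/-- The addition piece is locally of finite type over `K`. [folklore] -/
instance locallyOfFiniteType_AK_hom (i : AddIdx C g) : LocallyOfFiniteType (AK C hC hX g i).hom := by
  show LocallyOfFiniteType ((addV C hC hX g i).ι ≫ (WK C hC hX g ⊗ WK C hC hX g).hom)
  infer_instance

/-- The addition piece is reduced. [folklore] -/
instance isReduced_AK_left (i : AddIdx C g) : IsReduced (AK C hC hX g i).left := by
  show IsReduced (addV C hC hX g i : Scheme.{u})
  infer_instance

omit [CharZero K] in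
/-- A `K`-point of the piece, seen in `W ×_K W`, lies in the piece. [folklore] -/
theorem pt_comp_ιA_mem (i : AddIdx C g) (a : AlgPoints (AK C hC hX g i) K) :
    AlgPoints.pt (a ≫ ιA C hC hX g i) ∈ addV C hC hX g i := by
  rw [AlgPoints.pt_comp]
  exact (a.pt : addV C hC hX g i).2

omit [CharZero K] in
/-- A `K`-point of `W ×_K W` in the piece is a `K`-point of the piece. [folklore] -/
theorem exists_comp_ιA_eq (i : AddIdx C g) (w : AlgPoints (WK C hC hX g ⊗ WK C hC hX g) K)
    (hw : w.pt ∈ addV C hC hX g i) : ∃ a : AlgPoints (AK C hC hX g i) K, a ≫ ιA C hC hX g i = w :=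
  AlgPoints.exists_comp_eq_of_mem_range (ιA C hC hX g i) w (by
    show w.pt ∈ Set.range (addV C hC hX g i).ι
    rwa [Scheme.Opens.range_ι])

/-! ### The addition morphism on a piece -/

/-- The open `(ιW ⊗ ιW)(A_i)` of `C⁽ᵍ⁾ ×_K C⁽ᵍ⁾`, on which the master theorem is applied. [folklore] -/
abbrev addΩ (i : AddIdx C g) : (symPowProj C hC g ⊗ symPowProj C hC g).left.Opens :=
  (ιW C hC hX g ⊗ₘ ιW C hC hX g).left ''ᵁ addV C hC hX g i

/-- The source `K`-scheme of the master theorem (stated with `Over.mk`). [folklore] -/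
abbrev addΩK (i : AddIdx C g) : SchemeOver K :=
  Over.mk ((addΩ C hC hX g i).ι ≫ (symPowProj C hC g ⊗ symPowProj C hC g).hom)

/-- `A_i ≅ (ιW ⊗ ιW)(A_i)` over `K`. [folklore] -/
def isoAΩ (i : AddIdx C g) : AK C hC hX g i ≅ addΩK C hC hX g i :=
  Over.isoMk ((ιW C hC hX g ⊗ₘ ιW C hC hX g).left.isoImage (addV C hC hX g i)) (by
    show ((ιW C hC hX g ⊗ₘ ιW C hC hX g).left.isoImage (addV C hC hX g i)).hom ≫ (addΩ C hC hX g i).ι ≫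
      (symPowProj C hC g ⊗ symPowProj C hC g).hom = (addV C hC hX g i).ι ≫ (WK C hC hX g ⊗ WK C hC hX g).hom
    rw [Scheme.Hom.isoImage_hom_ι_assoc]
    exact congrArg ((addV C hC hX g i).ι ≫ ·) (Over.w (ιW C hC hX g ⊗ₘ ιW C hC hX g)))

omit [CharZero K] in
/-- `isoAΩ` followed by the inclusion is `ιA ≫ (ιW ⊗ ιW)`. [folklore] -/
@[reassoc]
theorem isoAΩ_hom_ι (i : AddIdx C g) :
    (isoAΩ C hC hX g i).hom ≫ (Over.homMk (addΩ C hC hX g i).ι rfl : addΩK C hC hX g i ⟶ symPowProj C hC g ⊗ symPowProj C hC g) =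
      ιA C hC hX g i ≫ (ιW C hC hX g ⊗ₘ ιW C hC hX g) := by
  refine Over.OverMorphism.ext ?_
  show ((ιW C hC hX g ⊗ₘ ιW C hC hX g).left.isoImage (addV C hC hX g i)).hom ≫ (addΩ C hC hX g i).ι =
    (addV C hC hX g i).ι ≫ (ιW C hC hX g ⊗ₘ ιW C hC hX g).left
  rw [Scheme.Hom.isoImage_hom_ι]

omit [CharZero K] in
include hg in
/-- On `K`-points of `(ιW ⊗ ιW)(A_i)`: `ℓ(…) = 1`. [folklore] -/
theorem ell_eq_one_of_pt_mem_addΩ (i : AddIdx C g) (w : AlgPoints (symPowProj C hC g ⊗ symPowProj C hC g) K)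
    (hw : w.pt ∈ addΩ C hC hX g i) :
    ell (liftDiv C g hC (w ≫ fst _ _) + liftDiv C g hC (w ≫ snd _ _) + tupleDiv C i.2.2 -
      tupleDiv C (Fin.append i.1 i.2.1)) = 1 := by
  obtain ⟨p, hp, hpw⟩ := hw
  obtain ⟨w', hw'⟩ := AlgPoints.exists_comp_eq_of_mem_range (ιW C hC hX g ⊗ₘ ιW C hC hX g) w ⟨p, hpw⟩
  have hp' : w'.pt = p := by
    apply (ιW C hC hX g ⊗ₘ ιW C hC hX g).left.isOpenEmbedding.injective
    rw [← AlgPoints.pt_comp, hw']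
    exact hpw.symm
  have h1 := ell_eq_one_of_pt_mem_addV C hC hX g hg i w' (hp' ▸ hp)
  rwa [Category.assoc, Category.assoc, ← tensorHom_fst (ιW C hC hX g) (ιW C hC hX g),
    ← tensorHom_snd (ιW C hC hX g) (ιW C hC hX g), ← Category.assoc, ← Category.assoc, hw'] at h1

include hg in
/-- The master theorem on `(ιW ⊗ ιW)(A_i)` (when non-empty). [cite: Milne1986JacobianVarieties, §7 (Weil's construction)] -/
theorem exists_addHom (i : AddIdx C g)
    (h : (addΩ C hC hX g i : Set (symPowProj C hC g ⊗ symPowProj C hC g).left).Nonempty) :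
    ∃ ψ : addΩK C hC hX g i ⟶ symPowProj C hC g,
      ∀ (t : AlgPoints (addΩK C hC hX g i) K) (R : Fin g → AlgPoints C K),
        Divisor.IsLinearlyEquivalent (tupleDiv C R)
          (liftDiv C g hC (t ≫ Over.homMk (addΩ C hC hX g i).ι rfl ≫ fst _ _) +
            liftDiv C g hC (t ≫ Over.homMk (addΩ C hC hX g i).ι rfl ≫ snd _ _) + tupleDiv C i.2.2 -
            tupleDiv C (Fin.append i.1 i.2.1)) →
        t ≫ ψ = tuplePt C (strPt (K := K) K) R ≫ symPowProj.mk C hC g :=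
  exists_hom_add C hC hX g hg i.2.2 (Fin.append i.1 i.2.1) rfl (addΩ C hC hX g i) h
    (ell_eq_one_of_pt_mem_addΩ C hC hX g hg i)

open Classical in
/-- **The addition morphism of a piece into `C⁽ᵍ⁾`**: `(E, F) ↦ E₃ ∼ E + F − Σ[R₁] − Σ[R₂] + Σ[R₃]`. [cite: Milne1986JacobianVarieties, §7 (Weil's construction)] -/
def addPK (i : AddIdx C g) : AK C hC hX g i ⟶ symPowProj C hC g :=
  if h : (addΩ C hC hX g i : Set (symPowProj C hC g ⊗ symPowProj C hC g).left).Nonempty then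
    (isoAΩ C hC hX g i).hom ≫ Classical.choose (exists_addHom C hC hX g hg i h)
  else ιA C hC hX g i ≫ fst _ _ ≫ ιW C hC hX g

/-- **The defining property of the addition morphism on `K`-points.** [cite: Milne1986JacobianVarieties, §7 (Weil's construction)] -/
theorem addPK_spec (i : AddIdx C g) (a : AlgPoints (AK C hC hX g i) K) (R : Fin g → AlgPoints C K)
    (h : Divisor.IsLinearlyEquivalent (tupleDiv C R)
      (liftDiv C g hC ((a ≫ ιA C hC hX g i ≫ fst _ _) ≫ ιW C hC hX g) +
        liftDiv C g hC ((a ≫ ιA C hC hX g i ≫ snd _ _) ≫ ιW C hC hX g) + tupleDiv C i.2.2 -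
        tupleDiv C (Fin.append i.1 i.2.1))) :
    a ≫ addPK C hC hX g hg i = tuplePt C (strPt (K := K) K) R ≫ symPowProj.mk C hC g := by
  have hne : (addΩ C hC hX g i : Set (symPowProj C hC g ⊗ symPowProj C hC g).left).Nonempty :=
    ⟨_, ⟨_, (a.pt : addV C hC hX g i).2, rfl⟩⟩
  have hψ := Classical.choose_spec (exists_addHom C hC hX g hg i hne) (a ≫ (isoAΩ C hC hX g i).hom) R (by
    simp only [Category.assoc, isoAΩ_hom_ι_assoc, tensorHom_fst, tensorHom_snd]
    simpa only [Category.assoc] using h)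
  have e : addPK C hC hX g hg i = (isoAΩ C hC hX g i).hom ≫ Classical.choose (exists_addHom C hC hX g hg i hne) :=
    dif_pos hne
  rw [e, ← Category.assoc]
  exact hψ

include hg in
/-- **`Ê(E₃) ∼ Ê(E) + Ê(F) − Σ[R₁] − Σ[R₂] + Σ[R₃]` and `ℓ(Ê(E₃)) = 1`.** [cite: Milne1986JacobianVarieties, §7 (Weil's construction)] -/
theorem liftDiv_addPK (i : AddIdx C g) (a : AlgPoints (AK C hC hX g i) K) :
    (liftDiv C g hC (a ≫ addPK C hC hX g hg i)).IsLinearlyEquivalent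
        (liftDiv C g hC ((a ≫ ιA C hC hX g i ≫ fst _ _) ≫ ιW C hC hX g) +
          liftDiv C g hC ((a ≫ ιA C hC hX g i ≫ snd _ _) ≫ ιW C hC hX g) + tupleDiv C i.2.2 -
          tupleDiv C (Fin.append i.1 i.2.1)) ∧
      ell (liftDiv C g hC (a ≫ addPK C hC hX g hg i)) = 1 := by
  have h1 : ell (liftDiv C g hC ((a ≫ ιA C hC hX g i ≫ fst _ _) ≫ ιW C hC hX g) +
      liftDiv C g hC ((a ≫ ιA C hC hX g i ≫ snd _ _) ≫ ιW C hC hX g) + tupleDiv C i.2.2 -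
      tupleDiv C (Fin.append i.1 i.2.1)) = 1 := by
    have := ell_eq_one_of_pt_mem_addV C hC hX g hg i _ (pt_comp_ιA_mem C hC hX g i a)
    simpa only [Category.assoc] using this
  have hdeg : (liftDiv C g hC ((a ≫ ιA C hC hX g i ≫ fst _ _) ≫ ιW C hC hX g) +
      liftDiv C g hC ((a ≫ ιA C hC hX g i ≫ snd _ _) ≫ ιW C hC hX g) + tupleDiv C i.2.2 -
      tupleDiv C (Fin.append i.1 i.2.1)).degree = g := by
    rw [map_sub, map_add, map_add, degree_liftDiv, degree_liftDiv, degree_tupleDiv, tupleDiv_append, map_add,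
      degree_tupleDiv, degree_tupleDiv]
    ring
  obtain ⟨R, hR⟩ := exists_tuple_isLinearlyEquivalent C hdeg hg
  replace hR : (tupleDiv C R).IsLinearlyEquivalent _ := hR
  rw [addPK_spec C hC hX g hg i a R hR, liftDiv_tuplePt_mk]
  exact ⟨hR, by rw [Divisor.IsLinearlyEquivalent.ell_eq hR]; exact h1⟩

include hg in
/-- The addition morphism lands in `W`. [folklore] -/
theorem range_addPK_subset (i : AddIdx C g) :
    Set.range (addPK C hC hX g hg i).left ⊆ Set.range (chartWOpens C g hC hX).ι := by
  rw [Scheme.Opens.range_ι]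
  rintro _ ⟨p, rfl⟩
  exact forall_mem_of_forall_pt_mem (addPK C hC hX g hg i) (isOpen_chartW C g hC hX)
    (fun a ↦ (pt_mem_chartW_iff C g hC _).mpr (liftDiv_addPK C hC hX g hg i a).2) p

/-- **The addition morphism of a piece into the chart `W`.** [folklore] -/
def addWK (i : AddIdx C g) : AK C hC hX g i ⟶ WK C hC hX g :=
  Over.homMk (IsOpenImmersion.lift (chartWOpens C g hC hX).ι (addPK C hC hX g hg i).left
    (range_addPK_subset C hC hX g hg i)) (by
      show IsOpenImmersion.lift _ _ _ ≫ (chartWOpens C g hC hX).ι ≫ (symPowProj C hC g).hom = _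
      rw [IsOpenImmersion.lift_fac_assoc]
      exact Over.w (addPK C hC hX g hg i))

/-- `addWK ≫ ιW = addPK`. [folklore] -/
@[reassoc (attr := simp)]
theorem addWK_ιW (i : AddIdx C g) : addWK C hC hX g hg i ≫ ιW C hC hX g = addPK C hC hX g hg i := by
  ext : 1
  exact IsOpenImmersion.lift_fac _ _ _

/-- **The addition morphism of the piece `A_{(R₁,R₂,R₃)}` into `J`, through the chart `R₃`.** [cite: Milne1986JacobianVarieties, §7 (Weil's construction)] -/
def addJ (i : AddIdx C g) : AK C hC hX g i ⟶ JK C hC hX g hg := addWK C hC hX g hg i ≫ chart C hC hX g hg i.2.2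

/-- **`cls (E +_i F) = cls [E − Σ[R₁]] + cls [F − Σ[R₂]]`.** [cite: Milne1986JacobianVarieties, §7 (Weil's construction)] -/
theorem cls_comp_addJ (i : AddIdx C g) (a : AlgPoints (AK C hC hX g i) K) :
    cls C hC hX g hg (a ≫ addJ C hC hX g hg i) =
      cls C hC hX g hg ((a ≫ ιA C hC hX g i ≫ fst _ _) ≫ chart C hC hX g hg i.1) +
        cls C hC hX g hg ((a ≫ ιA C hC hX g i ≫ snd _ _) ≫ chart C hC hX g hg i.2.1) := by
  rw [addJ, ← Category.assoc, cls_comp_chart, cls_comp_chart, cls_comp_chart, Category.assoc, addWK_ιW]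
  change DivisorClass.mk _ = DivisorClass.mk (_ + _)
  rw [DivisorClass.mk_eq_mk_iff]
  obtain ⟨hlin, -⟩ := liftDiv_addPK C hC hX g hg i a
  refine Divisor.IsLinearlyEquivalent.trans' (Divisor.IsLinearlyEquivalent.of_eq' (by abel))
    (Divisor.IsLinearlyEquivalent.trans' (Divisor.IsLinearlyEquivalent.add_right' hlin (-tupleDiv C i.2.2))
    (Divisor.IsLinearlyEquivalent.of_eq' ?_))
  rw [tupleDiv_append]
  abel

/-! ### The addition pieces cover `J ×_K J` -/

variable (hW : (chartW C g hC).Nonempty)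

omit [CharZero K] in
include hg hW in
/-- **Every pair of `K`-points of `W` lies in some addition piece**: with `E''` a `K`-point of `W`,
take `R₃` effective with `Σ[R₃] ∼ Ê(E'') − Ê(E) − Ê(F) + Σ[R₁] + Σ[R₂]` (degree `g ≥ genus`). [folklore] -/
theorem exists_pt_lift_mem_addV (R₁ R₂ : Fin g → AlgPoints C K) (x₁ x₂ : AlgPoints (WK C hC hX g) K) :
    ∃ R₃ : Fin g → AlgPoints C K, AlgPoints.pt (lift x₁ x₂) ∈ addV C hC hX g (R₁, R₂, R₃) := by
  obtain ⟨x⟩ := exists_algPoint_WK C hC hX g hW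
  have hdeg : (liftDiv C g hC (x ≫ ιW C hC hX g) - liftDiv C g hC (x₁ ≫ ιW C hC hX g) -
      liftDiv C g hC (x₂ ≫ ιW C hC hX g) + tupleDiv C (Fin.append R₁ R₂)).degree = g := by
    rw [map_add, map_sub, map_sub, degree_liftDiv, degree_liftDiv, degree_liftDiv, tupleDiv_append, map_add,
      degree_tupleDiv, degree_tupleDiv]
    ring
  obtain ⟨R₃, hR₃⟩ := exists_tuple_isLinearlyEquivalent C hdeg hg
  replace hR₃ : (tupleDiv C R₃).IsLinearlyEquivalent _ := hR₃
  refine ⟨R₃, (pt_mem_addV_iff C hC hX g _ _).mpr ?_⟩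
  rw [lift_fst, lift_snd]
  have key : (liftDiv C g hC (x₁ ≫ ιW C hC hX g) + liftDiv C g hC (x₂ ≫ ιW C hC hX g) + tupleDiv C R₃ -
      tupleDiv C (Fin.append R₁ R₂)).IsLinearlyEquivalent (liftDiv C g hC (x ≫ ιW C hC hX g)) :=
    Divisor.IsLinearlyEquivalent.trans' (Divisor.IsLinearlyEquivalent.of_eq' (by abel))
      (Divisor.IsLinearlyEquivalent.trans' (Divisor.IsLinearlyEquivalent.add_right' hR₃
        (liftDiv C g hC (x₁ ≫ ιW C hC hX g) + liftDiv C g hC (x₂ ≫ ιW C hC hX g) - tupleDiv C (Fin.append R₁ R₂)))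
        (Divisor.IsLinearlyEquivalent.of_eq' (by abel)))
  change ell (liftDiv C g hC (x₁ ≫ ιW C hC hX g) + liftDiv C g hC (x₂ ≫ ιW C hC hX g) + tupleDiv C R₃ -
      tupleDiv C (Fin.append R₁ R₂)) ≤ 1
  rw [Divisor.IsLinearlyEquivalent.ell_eq key]
  exact (ell_liftDiv_comp_ιW C hC hX g x).le

omit [CharZero K] in
include hg hW in
/-- **Every pair of `K`-points of `W` is a `K`-point of some addition piece.** [folklore] -/
theorem exists_comp_ιA_eq_lift (R₁ R₂ : Fin g → AlgPoints C K) (x₁ x₂ : AlgPoints (WK C hC hX g) K) :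
    ∃ (R₃ : Fin g → AlgPoints C K) (a : AlgPoints (AK C hC hX g (R₁, R₂, R₃)) K),
      a ≫ ιA C hC hX g (R₁, R₂, R₃) = lift x₁ x₂ := by
  obtain ⟨R₃, h⟩ := exists_pt_lift_mem_addV C hC hX g hg hW R₁ R₂ x₁ x₂
  obtain ⟨a, ha⟩ := exists_comp_ιA_eq C hC hX g _ _ h
  exact ⟨R₃, a, ha⟩

/-- `chart R₁ ⊗ chart R₂` is an open immersion. [folklore] -/
instance isOpenImmersion_chart_tensor_chart_left (R₁ R₂ : Fin g → AlgPoints C K) :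
    IsOpenImmersion (chart C hC hX g hg R₁ ⊗ₘ chart C hC hX g hg R₂).left :=
  isOpenImmersion_tensorHom_left _ _

/-- **The open immersion of the addition piece `A_{(R₁,R₂,R₃)}` into `J ×_K J`** (through the
charts `R₁`, `R₂`). [folklore] -/
def addMap (i : AddIdx C g) : (addV C hC hX g i : Scheme.{u}) ⟶ (JK C hC hX g hg ⊗ JK C hC hX g hg).left :=
  (addV C hC hX g i).ι ≫ (chart C hC hX g hg i.1 ⊗ₘ chart C hC hX g hg i.2.1).left

/-- `addMap` is an open immersion. [folklore] -/
instance isOpenImmersion_addMap (i : AddIdx C g) : IsOpenImmersion (addMap C hC hX g hg i) := by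
  unfold addMap
  infer_instance

/-- `addMap = (ιA ≫ (chart ⊗ chart)).left`. [folklore] -/
theorem addMap_eq (i : AddIdx C g) :
    addMap C hC hX g hg i = (ιA C hC hX g i ≫ (chart C hC hX g hg i.1 ⊗ₘ chart C hC hX g hg i.2.1)).left := rfl

/-- `J ×_K J → Spec K` is locally of finite type. [folklore] -/
instance locallyOfFiniteType_JK_tensor_hom : LocallyOfFiniteType (JK C hC hX g hg ⊗ JK C hC hX g hg).hom :=
  inferInstance

include hW in
/-- **The addition pieces cover `J ×_K J`** (they cover the `K`-points, and `J ×_K J` is Jacobson). [folklore] -/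
theorem exists_addMap_apply_eq (p : ↥(JK C hC hX g hg ⊗ JK C hC hX g hg).left) :
    ∃ (i : AddIdx C g) (y : addV C hC hX g i), addMap C hC hX g hg i y = p := by
  have hU : IsOpen (⋃ i : AddIdx C g, Set.range (addMap C hC hX g hg i)) :=
    isOpen_iUnion fun i ↦ (addMap C hC hX g hg i).isOpenEmbedding.isOpen_range
  have h := eq_univ_of_isOpen_of_forall_pt_mem (X := JK C hC hX g hg ⊗ JK C hC hX g hg) hU fun ζ ↦ by
    obtain ⟨R₁, x₁, h₁⟩ := exists_comp_chart_eq C hC hX g hg (ζ ≫ fst _ _)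
    obtain ⟨R₂, x₂, h₂⟩ := exists_comp_chart_eq C hC hX g hg (ζ ≫ snd _ _)
    obtain ⟨R₃, a, ha⟩ := exists_comp_ιA_eq_lift C hC hX g hg hW R₁ R₂ x₁ x₂
    refine Set.mem_iUnion.mpr ⟨(R₁, R₂, R₃), a.pt, ?_⟩
    rw [addMap_eq, ← AlgPoints.pt_comp, ← Category.assoc, ha, lift_map, h₁, h₂, AlgPoints.lift_fst_snd]
  have hp : p ∈ ⋃ i : AddIdx C g, Set.range (addMap C hC hX g hg i) := h ▸ Set.mem_univ p
  obtain ⟨i, y, hy⟩ := Set.mem_iUnion.mp hp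
  exact ⟨i, y, hy⟩

/-- **The open cover of `J ×_K J` by the addition pieces.** [folklore] -/
def addCover : (JK C hC hX g hg ⊗ JK C hC hX g hg).left.OpenCover :=
  Scheme.Cover.mkOfCovers (AddIdx C g) (fun i ↦ (addV C hC hX g i : Scheme.{u})) (addMap C hC hX g hg)
    (exists_addMap_apply_eq C hC hX g hg hW)

/-! ### Gluing the addition -/

/-- The intersection of two addition pieces (in `J ×_K J`) as a `K`-scheme. [folklore] -/
abbrev AQK (i j : AddIdx C g) : SchemeOver K :=
  overMk (pullback.fst (addMap C hC hX g hg i) (addMap C hC hX g hg j) ≫ (addV C hC hX g i).ι ≫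
    (WK C hC hX g ⊗ WK C hC hX g).hom)

/-- First projection of the intersection. [folklore] -/
abbrev aqfst (i j : AddIdx C g) : AQK C hC hX g hg i j ⟶ AK C hC hX g i :=
  Over.homMk (pullback.fst (addMap C hC hX g hg i) (addMap C hC hX g hg j)) rfl

/-- The structure maps of the pieces through `J ×_K J`. [folklore] -/
theorem addMap_comp_hom (i : AddIdx C g) :
    addMap C hC hX g hg i ≫ (JK C hC hX g hg ⊗ JK C hC hX g hg).hom = (addV C hC hX g i).ι ≫ (WK C hC hX g ⊗ WK C hC hX g).hom := by
  rw [addMap_eq]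
  exact Over.w (ιA C hC hX g i ≫ (chart C hC hX g hg i.1 ⊗ₘ chart C hC hX g hg i.2.1))

/-- Second projection of the intersection. [folklore] -/
abbrev aqsnd (i j : AddIdx C g) : AQK C hC hX g hg i j ⟶ AK C hC hX g j :=
  Over.homMk (pullback.snd (addMap C hC hX g hg i) (addMap C hC hX g hg j)) (by
    show pullback.snd _ _ ≫ (addV C hC hX g j).ι ≫ (WK C hC hX g ⊗ WK C hC hX g).hom =
      pullback.fst _ _ ≫ (addV C hC hX g i).ι ≫ (WK C hC hX g ⊗ WK C hC hX g).hom
    rw [← addMap_comp_hom, ← addMap_comp_hom, ← Category.assoc, ← pullback.condition, Category.assoc])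

/-- The two projections agree in `J ×_K J`. [folklore] -/
theorem aqfst_comp (i j : AddIdx C g) :
    aqfst C hC hX g hg i j ≫ ιA C hC hX g i ≫ (chart C hC hX g hg i.1 ⊗ₘ chart C hC hX g hg i.2.1) =
      aqsnd C hC hX g hg i j ≫ ιA C hC hX g j ≫ (chart C hC hX g hg j.1 ⊗ₘ chart C hC hX g hg j.2.1) := by
  refine Over.OverMorphism.ext ?_
  exact pullback.condition

/-- The intersection is locally of finite type over `K`. [folklore] -/
instance locallyOfFiniteType_AQK_hom (i j : AddIdx C g) : LocallyOfFiniteType (AQK C hC hX g hg i j).hom := by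
  show LocallyOfFiniteType (pullback.fst (addMap C hC hX g hg i) (addMap C hC hX g hg j) ≫ (addV C hC hX g i).ι ≫
    (WK C hC hX g ⊗ WK C hC hX g).hom)
  infer_instance

/-- The intersection is reduced. [folklore] -/
instance isReduced_AQK_left (i j : AddIdx C g) : IsReduced (AQK C hC hX g hg i j).left :=
  isReduced_of_isOpenImmersion (pullback.fst (addMap C hC hX g hg i) (addMap C hC hX g hg j))

/-- `J` is separated (instance form for products). [folklore] -/
instance isSeparated_JK_tensor_hom : IsSeparated (JK C hC hX g hg ⊗ JK C hC hX g hg).hom := inferInstance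

/-- **The addition morphisms agree on overlaps** (`cls` is injective and both have
`cls = cls z₁ + cls z₂`). [cite: Milne1986JacobianVarieties, §7 (proof of Thm. 7.1)] -/
theorem addJ_compat (i j : AddIdx C g) :
    pullback.fst (addMap C hC hX g hg i) (addMap C hC hX g hg j) ≫ (addJ C hC hX g hg i).left =
      pullback.snd (addMap C hC hX g hg i) (addMap C hC hX g hg j) ≫ (addJ C hC hX g hg j).left := by
  have key : aqfst C hC hX g hg i j ≫ addJ C hC hX g hg i = aqsnd C hC hX g hg i j ≫ addJ C hC hX g hg j := by
    refine SchemeOver.hom_ext_of_forall_algPoints K fun q ↦ ?_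
    apply cls_injective C hC hX g hg
    rw [← Category.assoc, ← Category.assoc, cls_comp_addJ, cls_comp_addJ]
    have hc := congrArg (q ≫ ·) (aqfst_comp C hC hX g hg i j)
    simp only [← Category.assoc] at hc
    have h1 := congrArg (· ≫ fst _ _) hc
    have h2 := congrArg (· ≫ snd _ _) hc
    simp only [Category.assoc, tensorHom_fst, tensorHom_snd] at h1 h2
    simp only [Category.assoc] at h1 h2 ⊢
    rw [h1, h2]
  exact congrArg CommaMorphism.left key

/-- **The addition `m : J ×_K J → J`** (glued from the `addJ i`). [cite: Milne1986JacobianVarieties, §7 Thm. 7.1 (proof)] -/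
def addGlued : (JK C hC hX g hg ⊗ JK C hC hX g hg).left ⟶ J C hC hX g hg :=
  (addCover C hC hX g hg hW).glueMorphisms (fun i ↦ (addJ C hC hX g hg i).left) (addJ_compat C hC hX g hg)

/-- `m` on the piece `A_i` is `addJ i`. [folklore] -/
theorem addMap_addGlued (i : AddIdx C g) :
    addMap C hC hX g hg i ≫ addGlued C hC hX g hg hW = (addJ C hC hX g hg i).left :=
  (addCover C hC hX g hg hW).ι_glueMorphisms _ _ i

/-- **The addition `m : J ×_K J → J` as a `K`-morphism.** [cite: Milne1986JacobianVarieties, §7 Thm. 7.1 (proof)] -/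
def mK : JK C hC hX g hg ⊗ JK C hC hX g hg ⟶ JK C hC hX g hg :=
  Over.homMk (addGlued C hC hX g hg hW) (by
    refine (addCover C hC hX g hg hW).hom_ext _ _ fun i ↦ ?_
    show addMap C hC hX g hg i ≫ addGlued C hC hX g hg hW ≫ Jbase C hC hX g hg =
      addMap C hC hX g hg i ≫ (JK C hC hX g hg ⊗ JK C hC hX g hg).hom
    rw [← Category.assoc, addMap_addGlued, addMap_comp_hom]
    exact Over.w (addJ C hC hX g hg i))

/-- `m` on the piece `A_i` (over `K`). [folklore] -/
theorem ιA_tensor_mK (i : AddIdx C g) :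
    ιA C hC hX g i ≫ (chart C hC hX g hg i.1 ⊗ₘ chart C hC hX g hg i.2.1) ≫ mK C hC hX g hg hW = addJ C hC hX g hg i := by
  refine Over.OverMorphism.ext ?_
  exact addMap_addGlued C hC hX g hg hW i

/-- **`cls (z₁ + z₂) = cls z₁ + cls z₂` on `K`-points.** [cite: Milne1986JacobianVarieties, §7 Thm. 7.1 (proof)] -/
theorem cls_mul (z₁ z₂ : AlgPoints (JK C hC hX g hg) K) :
    cls C hC hX g hg (lift z₁ z₂ ≫ mK C hC hX g hg hW) = cls C hC hX g hg z₁ + cls C hC hX g hg z₂ := by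
  obtain ⟨R₁, x₁, rfl⟩ := exists_comp_chart_eq C hC hX g hg z₁
  obtain ⟨R₂, x₂, rfl⟩ := exists_comp_chart_eq C hC hX g hg z₂
  obtain ⟨R₃, a, ha⟩ := exists_comp_ιA_eq_lift C hC hX g hg hW R₁ R₂ x₁ x₂
  rw [← lift_map, ← ha, Category.assoc, Category.assoc, ιA_tensor_mK, cls_comp_addJ, ← Category.assoc,
    ← Category.assoc, ha, lift_fst, lift_snd]

/-! ### The inversion pieces: `E ↦ E' ∼ −E + Σ[R] + Σ[R']` -/

/-- **The open `{y : ℓ(−Ê(y) + Σ[R] + Σ[R']) ≤ 1}` of `C⁽ᵍ⁾`.** [folklore] -/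
def invOpens (R R' : Fin g → AlgPoints C K) : (symPowProj C hC g).left.Opens :=
  opensOfAlgPoints (symPowProj C hC g) fun y ↦ ell (-liftDiv C g hC y + tupleDiv C (Fin.append R R')) ≤ 1

omit [IsAlgClosed K] [CharZero K] [AlgebraicGeometry.IsIntegral (Over.left C)] in
/-- The empty tuple has divisor `0`. [folklore] -/
theorem tupleDiv_empty : tupleDiv C (![] : Fin 0 → AlgPoints C K) = 0 := by
  simp [tupleDiv]

omit [CharZero K] in
include hX in
/-- `K`-points of `invOpens R R'`. [folklore] -/
theorem pt_mem_invOpens_iff (R R' : Fin g → AlgPoints C K) (y : AlgPoints (symPowProj C hC g) K) :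
    y.pt ∈ invOpens C hC g R R' ↔ ell (-liftDiv C g hC y + tupleDiv C (Fin.append R R')) ≤ 1 := by
  refine pt_mem_opensOfAlgPoints_iff ?_ y
  obtain ⟨U, hU⟩ := exists_opens_symPowProj_pt_mem_iff_neg C hX g hC 1 (Fin.append R R') (![] : Fin 0 → AlgPoints C K)
  refine ⟨U, fun z ↦ ?_⟩
  obtain ⟨R₀, hR₀⟩ := exists_tuplePt_mk_eq C g hC z
  rw [← hR₀, hU, liftDiv_tuplePt_mk, tupleDiv_empty, sub_zero]

/-- **The inversion piece `I_{R,R'} ⊆ W`**: `ℓ(−Ê(E) + Σ[R] + Σ[R']) ≤ 1`. [cite: Milne1986JacobianVarieties, §7 (proof of Thm. 7.1)] -/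
abbrev invV (R R' : Fin g → AlgPoints C K) : (WK C hC hX g).left.Opens :=
  (chartWOpens C g hC hX).ι ⁻¹ᵁ invOpens C hC g R R'

omit [CharZero K] in
/-- `K`-points of the inversion piece. [folklore] -/
theorem pt_mem_invV_iff (R R' : Fin g → AlgPoints C K) (x : AlgPoints (WK C hC hX g) K) :
    x.pt ∈ invV C hC hX g R R' ↔ ell (-liftDiv C g hC (x ≫ ιW C hC hX g) + tupleDiv C (Fin.append R R')) ≤ 1 := by
  rw [← pt_mem_invOpens_iff C hC hX g R R', AlgPoints.pt_comp]
  rfl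

omit [CharZero K] in
include hg in
/-- On the inversion piece `ℓ(…) = 1` (Riemann). [folklore] -/
theorem ell_eq_one_of_pt_mem_invV (R R' : Fin g → AlgPoints C K) (x : AlgPoints (WK C hC hX g) K)
    (hx : x.pt ∈ invV C hC hX g R R') :
    ell (-liftDiv C g hC (x ≫ ιW C hC hX g) + tupleDiv C (Fin.append R R')) = 1 := by
  refine le_antisymm ((pt_mem_invV_iff C hC hX g R R' x).mp hx) (one_le_ell_of_degree_eq C g hg ?_)
  rw [map_add, map_neg, degree_liftDiv, tupleDiv_append, map_add, degree_tupleDiv, degree_tupleDiv]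
  ring

/-- The inversion piece as a `K`-scheme. [folklore] -/
abbrev IK (R R' : Fin g → AlgPoints C K) : SchemeOver K := overMk ((invV C hC hX g R R').ι ≫ (WK C hC hX g).hom)

/-- The inclusion of the inversion piece into `W`. [folklore] -/
abbrev ιI (R R' : Fin g → AlgPoints C K) : IK C hC hX g R R' ⟶ WK C hC hX g := Over.homMk (invV C hC hX g R R').ι rfl

/-- `ιI` is an open immersion. [folklore] -/
instance isOpenImmersion_ιI_left (R R' : Fin g → AlgPoints C K) : IsOpenImmersion (ιI C hC hX g R R').left :=
  inferInstanceAs (IsOpenImmersion (invV C hC hX g R R').ι)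

/-- The inversion piece is locally of finite type over `K`. [folklore] -/
instance locallyOfFiniteType_IK_hom (R R' : Fin g → AlgPoints C K) : LocallyOfFiniteType (IK C hC hX g R R').hom := by
  show LocallyOfFiniteType ((invV C hC hX g R R').ι ≫ (WK C hC hX g).hom)
  infer_instance

/-- The inversion piece is reduced. [folklore] -/
instance isReduced_IK_left (R R' : Fin g → AlgPoints C K) : IsReduced (IK C hC hX g R R').left := by
  show IsReduced (invV C hC hX g R R' : Scheme.{u})
  infer_instance

omit [CharZero K] in
/-- A `K`-point of the piece, seen in `W`, lies in the piece. [folklore] -/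
theorem pt_comp_ιI_mem (R R' : Fin g → AlgPoints C K) (a : AlgPoints (IK C hC hX g R R') K) :
    AlgPoints.pt (a ≫ ιI C hC hX g R R') ∈ invV C hC hX g R R' := by
  rw [AlgPoints.pt_comp]
  exact (a.pt : invV C hC hX g R R').2

omit [CharZero K] in
/-- A `K`-point of `W` in the piece is a `K`-point of the piece. [folklore] -/
theorem exists_comp_ιI_eq (R R' : Fin g → AlgPoints C K) (x : AlgPoints (WK C hC hX g) K)
    (hx : x.pt ∈ invV C hC hX g R R') : ∃ a : AlgPoints (IK C hC hX g R R') K, a ≫ ιI C hC hX g R R' = x :=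
  AlgPoints.exists_comp_eq_of_mem_range (ιI C hC hX g R R') x (by
    show x.pt ∈ Set.range (invV C hC hX g R R').ι
    rwa [Scheme.Opens.range_ι])

/-- The open `W.ι(I_{R,R'})` of `C⁽ᵍ⁾`. [folklore] -/
abbrev invΩ (R R' : Fin g → AlgPoints C K) : (symPowProj C hC g).left.Opens :=
  (chartWOpens C g hC hX).ι ''ᵁ invV C hC hX g R R'

/-- The source `K`-scheme of the master theorem (stated with `Over.mk`). [folklore] -/
abbrev invΩK (R R' : Fin g → AlgPoints C K) : SchemeOver K :=
  Over.mk ((invΩ C hC hX g R R').ι ≫ (symPowProj C hC g).hom)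

/-- `I_{R,R'} ≅ W.ι(I_{R,R'})` over `K`. [folklore] -/
def isoIΩ (R R' : Fin g → AlgPoints C K) : IK C hC hX g R R' ≅ invΩK C hC hX g R R' :=
  Over.isoMk ((chartWOpens C g hC hX).ι.isoImage (invV C hC hX g R R')) (by
    show ((chartWOpens C g hC hX).ι.isoImage (invV C hC hX g R R')).hom ≫ (invΩ C hC hX g R R').ι ≫
      (symPowProj C hC g).hom = (invV C hC hX g R R').ι ≫ (chartWOpens C g hC hX).ι ≫ (symPowProj C hC g).hom
    rw [Scheme.Hom.isoImage_hom_ι_assoc])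

omit [CharZero K] in
/-- `isoIΩ` followed by the inclusion is `ιI ≫ ιW`. [folklore] -/
@[reassoc]
theorem isoIΩ_hom_ι (R R' : Fin g → AlgPoints C K) :
    (isoIΩ C hC hX g R R').hom ≫ (Over.homMk (invΩ C hC hX g R R').ι rfl : invΩK C hC hX g R R' ⟶ symPowProj C hC g) =
      ιI C hC hX g R R' ≫ ιW C hC hX g := by
  refine Over.OverMorphism.ext ?_
  show ((chartWOpens C g hC hX).ι.isoImage (invV C hC hX g R R')).hom ≫ (invΩ C hC hX g R R').ι =
    (invV C hC hX g R R').ι ≫ (chartWOpens C g hC hX).ι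
  rw [Scheme.Hom.isoImage_hom_ι]

omit [CharZero K] in
include hg in
/-- On `K`-points of `W.ι(I_{R,R'})`: `ℓ(…) = 1`. [folklore] -/
theorem ell_eq_one_of_pt_mem_invΩ (R R' : Fin g → AlgPoints C K) (y : AlgPoints (symPowProj C hC g) K)
    (hy : y.pt ∈ invΩ C hC hX g R R') :
    ell (-liftDiv C g hC y + tupleDiv C (Fin.append R R') - tupleDiv C (![] : Fin 0 → AlgPoints C K)) = 1 := by
  rw [tupleDiv_empty, sub_zero]
  obtain ⟨p, hp, hpy⟩ := hy
  obtain ⟨x, hx⟩ := exists_comp_ιW_eq C hC hX g y (by rw [← hpy]; exact p.2)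
  have hp' : x.pt = p := by
    apply (chartWOpens C g hC hX).ι.isOpenEmbedding.injective
    change (ιW C hC hX g).left x.pt = _
    rw [← AlgPoints.pt_comp, hx]
    exact hpy.symm
  rw [← hx]
  exact ell_eq_one_of_pt_mem_invV C hC hX g hg R R' x (hp' ▸ hp)

include hg in
/-- The master theorem on `W.ι(I_{R,R'})` (when non-empty). [cite: Milne1986JacobianVarieties, §7 (Weil's construction)] -/
theorem exists_invHom (R R' : Fin g → AlgPoints C K)
    (h : (invΩ C hC hX g R R' : Set (symPowProj C hC g).left).Nonempty) :
    ∃ ψ : invΩK C hC hX g R R' ⟶ symPowProj C hC g,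
      ∀ (t : AlgPoints (invΩK C hC hX g R R') K) (R₁ : Fin g → AlgPoints C K),
        Divisor.IsLinearlyEquivalent (tupleDiv C R₁)
          (-liftDiv C g hC (t ≫ Over.homMk (invΩ C hC hX g R R').ι rfl) + tupleDiv C (Fin.append R R') -
            tupleDiv C (![] : Fin 0 → AlgPoints C K)) →
        t ≫ ψ = tuplePt C (strPt (K := K) K) R₁ ≫ symPowProj.mk C hC g :=
  exists_hom_reflect C hC hX g hg (Fin.append R R') ![] (by ring) (invΩ C hC hX g R R') h
    (ell_eq_one_of_pt_mem_invΩ C hC hX g hg R R')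

open Classical in
/-- **The inversion morphism of a piece into `C⁽ᵍ⁾`**: `E ↦ E' ∼ −E + Σ[R] + Σ[R']`. [cite: Milne1986JacobianVarieties, §7 (Weil's construction)] -/
def invPK (R R' : Fin g → AlgPoints C K) : IK C hC hX g R R' ⟶ symPowProj C hC g :=
  if h : (invΩ C hC hX g R R' : Set (symPowProj C hC g).left).Nonempty then
    (isoIΩ C hC hX g R R').hom ≫ Classical.choose (exists_invHom C hC hX g hg R R' h)
  else ιI C hC hX g R R' ≫ ιW C hC hX g

/-- **The defining property of the inversion morphism on `K`-points.** [cite: Milne1986JacobianVarieties, §7 (Weil's construction)] -/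
theorem invPK_spec (R R' : Fin g → AlgPoints C K) (a : AlgPoints (IK C hC hX g R R') K) (R₁ : Fin g → AlgPoints C K)
    (h : Divisor.IsLinearlyEquivalent (tupleDiv C R₁)
      (-liftDiv C g hC (a ≫ ιI C hC hX g R R' ≫ ιW C hC hX g) + tupleDiv C (Fin.append R R'))) :
    a ≫ invPK C hC hX g hg R R' = tuplePt C (strPt (K := K) K) R₁ ≫ symPowProj.mk C hC g := by
  have hne : (invΩ C hC hX g R R' : Set (symPowProj C hC g).left).Nonempty :=
    ⟨_, ⟨_, (a.pt : invV C hC hX g R R').2, rfl⟩⟩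
  have hψ := Classical.choose_spec (exists_invHom C hC hX g hg R R' hne) (a ≫ (isoIΩ C hC hX g R R').hom) R₁ (by
    rw [Category.assoc, isoIΩ_hom_ι, tupleDiv_empty, sub_zero]; exact h)
  have e : invPK C hC hX g hg R R' = (isoIΩ C hC hX g R R').hom ≫ Classical.choose (exists_invHom C hC hX g hg R R' hne) :=
    dif_pos hne
  rw [e, ← Category.assoc]
  exact hψ

include hg in
/-- **`Ê(E') ∼ −Ê(E) + Σ[R] + Σ[R']` and `ℓ(Ê(E')) = 1`.** [cite: Milne1986JacobianVarieties, §7 (Weil's construction)] -/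
theorem liftDiv_invPK (R R' : Fin g → AlgPoints C K) (a : AlgPoints (IK C hC hX g R R') K) :
    (liftDiv C g hC (a ≫ invPK C hC hX g hg R R')).IsLinearlyEquivalent
        (-liftDiv C g hC (a ≫ ιI C hC hX g R R' ≫ ιW C hC hX g) + tupleDiv C (Fin.append R R')) ∧
      ell (liftDiv C g hC (a ≫ invPK C hC hX g hg R R')) = 1 := by
  have h1 : ell (-liftDiv C g hC (a ≫ ιI C hC hX g R R' ≫ ιW C hC hX g) + tupleDiv C (Fin.append R R')) = 1 := by
    have := ell_eq_one_of_pt_mem_invV C hC hX g hg R R' _ (pt_comp_ιI_mem C hC hX g R R' a)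
    rwa [Category.assoc] at this
  have hdeg : (-liftDiv C g hC (a ≫ ιI C hC hX g R R' ≫ ιW C hC hX g) + tupleDiv C (Fin.append R R')).degree = g := by
    rw [map_add, map_neg, degree_liftDiv, tupleDiv_append, map_add, degree_tupleDiv, degree_tupleDiv]
    ring
  obtain ⟨R₁, hR₁⟩ := exists_tuple_isLinearlyEquivalent C hdeg hg
  replace hR₁ : (tupleDiv C R₁).IsLinearlyEquivalent _ := hR₁
  rw [invPK_spec C hC hX g hg R R' a R₁ hR₁, liftDiv_tuplePt_mk]
  exact ⟨hR₁, by rw [Divisor.IsLinearlyEquivalent.ell_eq hR₁]; exact h1⟩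

include hg in
/-- The inversion morphism lands in `W`. [folklore] -/
theorem range_invPK_subset (R R' : Fin g → AlgPoints C K) :
    Set.range (invPK C hC hX g hg R R').left ⊆ Set.range (chartWOpens C g hC hX).ι := by
  rw [Scheme.Opens.range_ι]
  rintro _ ⟨p, rfl⟩
  exact forall_mem_of_forall_pt_mem (invPK C hC hX g hg R R') (isOpen_chartW C g hC hX)
    (fun a ↦ (pt_mem_chartW_iff C g hC _).mpr (liftDiv_invPK C hC hX g hg R R' a).2) p

/-- **The inversion morphism of a piece into the chart `W`.** [folklore] -/
def invWK (R R' : Fin g → AlgPoints C K) : IK C hC hX g R R' ⟶ WK C hC hX g :=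
  Over.homMk (IsOpenImmersion.lift (chartWOpens C g hC hX).ι (invPK C hC hX g hg R R').left
    (range_invPK_subset C hC hX g hg R R')) (by
      show IsOpenImmersion.lift _ _ _ ≫ (chartWOpens C g hC hX).ι ≫ (symPowProj C hC g).hom = _
      rw [IsOpenImmersion.lift_fac_assoc]
      exact Over.w (invPK C hC hX g hg R R'))

/-- `invWK ≫ ιW = invPK`. [folklore] -/
@[reassoc (attr := simp)]
theorem invWK_ιW (R R' : Fin g → AlgPoints C K) : invWK C hC hX g hg R R' ≫ ιW C hC hX g = invPK C hC hX g hg R R' := by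
  ext : 1
  exact IsOpenImmersion.lift_fac _ _ _

/-- **The inversion morphism of the piece `I_{R,R'}` into `J`, through the chart `R'`.** [cite: Milne1986JacobianVarieties, §7 (Weil's construction)] -/
def invJ (R R' : Fin g → AlgPoints C K) : IK C hC hX g R R' ⟶ JK C hC hX g hg :=
  invWK C hC hX g hg R R' ≫ chart C hC hX g hg R'

/-- **`cls (E') = −cls [E − Σ[R]]`.** [cite: Milne1986JacobianVarieties, §7 (Weil's construction)] -/
theorem cls_comp_invJ (R R' : Fin g → AlgPoints C K) (a : AlgPoints (IK C hC hX g R R') K) :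
    cls C hC hX g hg (a ≫ invJ C hC hX g hg R R') = -cls C hC hX g hg ((a ≫ ιI C hC hX g R R') ≫ chart C hC hX g hg R) := by
  rw [invJ, ← Category.assoc, cls_comp_chart, cls_comp_chart, Category.assoc, invWK_ιW]
  rw [← QuotientAddGroup.mk_neg]
  change DivisorClass.mk _ = DivisorClass.mk _
  rw [DivisorClass.mk_eq_mk_iff]
  obtain ⟨hlin, -⟩ := liftDiv_invPK C hC hX g hg R R' a
  refine Divisor.IsLinearlyEquivalent.trans' (Divisor.IsLinearlyEquivalent.of_eq' (by abel))
    (Divisor.IsLinearlyEquivalent.trans' (Divisor.IsLinearlyEquivalent.add_right' hlin (-tupleDiv C R'))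
    (Divisor.IsLinearlyEquivalent.of_eq' ?_))
  rw [tupleDiv_append, Category.assoc]
  abel

/-! ### The inversion pieces cover `J` -/

omit [CharZero K] in
include hg hW in
/-- **Every `K`-point of `W` lies in some inversion piece `I_{R,R'}`**: take `R'` effective with
`Σ[R'] ∼ Ê(E'') + Ê(E) − Σ[R]`. [folklore] -/
theorem exists_pt_mem_invV (R : Fin g → AlgPoints C K) (x : AlgPoints (WK C hC hX g) K) :
    ∃ R' : Fin g → AlgPoints C K, x.pt ∈ invV C hC hX g R R' := by
  obtain ⟨x''⟩ := exists_algPoint_WK C hC hX g hW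
  have hdeg : (liftDiv C g hC (x'' ≫ ιW C hC hX g) + liftDiv C g hC (x ≫ ιW C hC hX g) - tupleDiv C R).degree = g := by
    rw [map_sub, map_add, degree_liftDiv, degree_liftDiv, degree_tupleDiv]; ring
  obtain ⟨R', hR'⟩ := exists_tuple_isLinearlyEquivalent C hdeg hg
  replace hR' : (tupleDiv C R').IsLinearlyEquivalent _ := hR'
  refine ⟨R', (pt_mem_invV_iff C hC hX g R R' x).mpr ?_⟩
  have key : (-liftDiv C g hC (x ≫ ιW C hC hX g) + tupleDiv C (Fin.append R R')).IsLinearlyEquivalent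
      (liftDiv C g hC (x'' ≫ ιW C hC hX g)) := by
    rw [tupleDiv_append]
    exact Divisor.IsLinearlyEquivalent.trans' (Divisor.IsLinearlyEquivalent.of_eq' (by abel))
      (Divisor.IsLinearlyEquivalent.trans' (Divisor.IsLinearlyEquivalent.add_right' hR'
        (-liftDiv C g hC (x ≫ ιW C hC hX g) + tupleDiv C R)) (Divisor.IsLinearlyEquivalent.of_eq' (by abel)))
  rw [Divisor.IsLinearlyEquivalent.ell_eq key]
  exact (ell_liftDiv_comp_ιW C hC hX g x'').le

/-- Index of an inversion piece: the two charts `(R, R')`. [folklore] -/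
abbrev InvIdx : Type u := (Fin g → AlgPoints C K) × (Fin g → AlgPoints C K)

/-- **The open immersion of the inversion piece `I_{(R,R')}` into `J`** (through the chart `R`). [folklore] -/
def invMap (i : InvIdx C g) : (invV C hC hX g i.1 i.2 : Scheme.{u}) ⟶ J C hC hX g hg :=
  (invV C hC hX g i.1 i.2).ι ≫ (chart C hC hX g hg i.1).left

/-- `invMap` is an open immersion. [folklore] -/
instance isOpenImmersion_invMap (i : InvIdx C g) : IsOpenImmersion (invMap C hC hX g hg i) := by
  unfold invMap
  infer_instance

/-- `invMap = (ιI ≫ chart).left`. [folklore] -/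
theorem invMap_eq (i : InvIdx C g) : invMap C hC hX g hg i = (ιI C hC hX g i.1 i.2 ≫ chart C hC hX g hg i.1).left := rfl

include hW in
/-- **The inversion pieces cover `J`.** [folklore] -/
theorem exists_invMap_apply_eq (p : ↥(J C hC hX g hg)) :
    ∃ (i : InvIdx C g) (y : invV C hC hX g i.1 i.2), invMap C hC hX g hg i y = p := by
  have hU : IsOpen (⋃ i : InvIdx C g, Set.range (invMap C hC hX g hg i)) :=
    isOpen_iUnion fun i ↦ (invMap C hC hX g hg i).isOpenEmbedding.isOpen_range
  have h := eq_univ_of_isOpen_of_forall_pt_mem (X := JK C hC hX g hg) hU fun z ↦ by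
    obtain ⟨R, x, rfl⟩ := exists_comp_chart_eq C hC hX g hg z
    obtain ⟨R', hR'⟩ := exists_pt_mem_invV C hC hX g hg hW R x
    obtain ⟨a, ha⟩ := exists_comp_ιI_eq C hC hX g R R' x hR'
    refine Set.mem_iUnion.mpr ⟨(R, R'), a.pt, ?_⟩
    rw [invMap_eq, ← AlgPoints.pt_comp, ← Category.assoc, ha]
  have hp : p ∈ ⋃ i : InvIdx C g, Set.range (invMap C hC hX g hg i) := h ▸ Set.mem_univ p
  obtain ⟨i, y, hy⟩ := Set.mem_iUnion.mp hp
  exact ⟨i, y, hy⟩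

/-- **The open cover of `J` by the inversion pieces.** [folklore] -/
def invCover : (J C hC hX g hg).OpenCover :=
  Scheme.Cover.mkOfCovers (InvIdx C g) (fun i ↦ (invV C hC hX g i.1 i.2 : Scheme.{u})) (invMap C hC hX g hg)
    (exists_invMap_apply_eq C hC hX g hg hW)

/-! ### Gluing the inversion -/

/-- The intersection of two inversion pieces (in `J`) as a `K`-scheme. [folklore] -/
abbrev IQK (i j : InvIdx C g) : SchemeOver K :=
  overMk (pullback.fst (invMap C hC hX g hg i) (invMap C hC hX g hg j) ≫ (invV C hC hX g i.1 i.2).ι ≫ (WK C hC hX g).hom)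

/-- The structure maps of the pieces through `J`. [folklore] -/
theorem invMap_comp_hom (i : InvIdx C g) :
    invMap C hC hX g hg i ≫ (JK C hC hX g hg).hom = (invV C hC hX g i.1 i.2).ι ≫ (WK C hC hX g).hom := by
  rw [invMap_eq]
  exact Over.w (ιI C hC hX g i.1 i.2 ≫ chart C hC hX g hg i.1)

/-- First projection of the intersection. [folklore] -/
abbrev iqfst (i j : InvIdx C g) : IQK C hC hX g hg i j ⟶ IK C hC hX g i.1 i.2 :=
  Over.homMk (pullback.fst (invMap C hC hX g hg i) (invMap C hC hX g hg j)) rfl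

/-- Second projection of the intersection. [folklore] -/
abbrev iqsnd (i j : InvIdx C g) : IQK C hC hX g hg i j ⟶ IK C hC hX g j.1 j.2 :=
  Over.homMk (pullback.snd (invMap C hC hX g hg i) (invMap C hC hX g hg j)) (by
    show pullback.snd _ _ ≫ (invV C hC hX g j.1 j.2).ι ≫ (WK C hC hX g).hom =
      pullback.fst _ _ ≫ (invV C hC hX g i.1 i.2).ι ≫ (WK C hC hX g).hom
    rw [← invMap_comp_hom, ← invMap_comp_hom, ← Category.assoc, ← pullback.condition, Category.assoc])

/-- The two projections agree in `J`. [folklore] -/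
theorem iqfst_comp (i j : InvIdx C g) :
    iqfst C hC hX g hg i j ≫ ιI C hC hX g i.1 i.2 ≫ chart C hC hX g hg i.1 =
      iqsnd C hC hX g hg i j ≫ ιI C hC hX g j.1 j.2 ≫ chart C hC hX g hg j.1 := by
  refine Over.OverMorphism.ext ?_
  exact pullback.condition

/-- The intersection is locally of finite type over `K`. [folklore] -/
instance locallyOfFiniteType_IQK_hom (i j : InvIdx C g) : LocallyOfFiniteType (IQK C hC hX g hg i j).hom := by
  show LocallyOfFiniteType (pullback.fst (invMap C hC hX g hg i) (invMap C hC hX g hg j) ≫ (invV C hC hX g i.1 i.2).ι ≫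
    (WK C hC hX g).hom)
  infer_instance

/-- The intersection is reduced. [folklore] -/
instance isReduced_IQK_left (i j : InvIdx C g) : IsReduced (IQK C hC hX g hg i j).left :=
  isReduced_of_isOpenImmersion (pullback.fst (invMap C hC hX g hg i) (invMap C hC hX g hg j))

/-- **The inversion morphisms agree on overlaps.** [cite: Milne1986JacobianVarieties, §7 (proof of Thm. 7.1)] -/
theorem invJ_compat (i j : InvIdx C g) :
    pullback.fst (invMap C hC hX g hg i) (invMap C hC hX g hg j) ≫ (invJ C hC hX g hg i.1 i.2).left =
      pullback.snd (invMap C hC hX g hg i) (invMap C hC hX g hg j) ≫ (invJ C hC hX g hg j.1 j.2).left := by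
  have key : iqfst C hC hX g hg i j ≫ invJ C hC hX g hg i.1 i.2 = iqsnd C hC hX g hg i j ≫ invJ C hC hX g hg j.1 j.2 := by
    refine SchemeOver.hom_ext_of_forall_algPoints K fun q ↦ ?_
    apply cls_injective C hC hX g hg
    rw [← Category.assoc, ← Category.assoc, cls_comp_invJ, cls_comp_invJ]
    have hc := congrArg (q ≫ ·) (iqfst_comp C hC hX g hg i j)
    simp only [Category.assoc] at hc ⊢
    rw [hc]
  exact congrArg CommaMorphism.left key

/-- **The inversion `inv : J → J`** (glued from the `invJ i`). [cite: Milne1986JacobianVarieties, §7 Thm. 7.1 (proof)] -/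
def invGlued : J C hC hX g hg ⟶ J C hC hX g hg :=
  (invCover C hC hX g hg hW).glueMorphisms (fun i ↦ (invJ C hC hX g hg i.1 i.2).left) (invJ_compat C hC hX g hg)

/-- `inv` on the piece `I_i` is `invJ i`. [folklore] -/
theorem invMap_invGlued (i : InvIdx C g) :
    invMap C hC hX g hg i ≫ invGlued C hC hX g hg hW = (invJ C hC hX g hg i.1 i.2).left :=
  (invCover C hC hX g hg hW).ι_glueMorphisms _ _ i

/-- **The inversion `inv : J → J` as a `K`-morphism.** [cite: Milne1986JacobianVarieties, §7 Thm. 7.1 (proof)] -/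
def invK : JK C hC hX g hg ⟶ JK C hC hX g hg :=
  Over.homMk (invGlued C hC hX g hg hW) (by
    refine (invCover C hC hX g hg hW).hom_ext _ _ fun i ↦ ?_
    show invMap C hC hX g hg i ≫ invGlued C hC hX g hg hW ≫ Jbase C hC hX g hg = invMap C hC hX g hg i ≫ (JK C hC hX g hg).hom
    rw [← Category.assoc, invMap_invGlued, invMap_comp_hom]
    exact Over.w (invJ C hC hX g hg i.1 i.2))

/-- `inv` on the piece `I_{(R,R')}` (over `K`). [folklore] -/
theorem ιI_chart_invK (R R' : Fin g → AlgPoints C K) :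
    ιI C hC hX g R R' ≫ chart C hC hX g hg R ≫ invK C hC hX g hg hW = invJ C hC hX g hg R R' := by
  refine Over.OverMorphism.ext ?_
  exact invMap_invGlued C hC hX g hg hW (R, R')

/-- **`cls (inv z) = −cls z` on `K`-points.** [cite: Milne1986JacobianVarieties, §7 Thm. 7.1 (proof)] -/
theorem cls_inv (z : AlgPoints (JK C hC hX g hg) K) :
    cls C hC hX g hg (z ≫ invK C hC hX g hg hW) = -cls C hC hX g hg z := by
  obtain ⟨R, x, rfl⟩ := exists_comp_chart_eq C hC hX g hg z
  obtain ⟨R', hR'⟩ := exists_pt_mem_invV C hC hX g hg hW R x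
  obtain ⟨a, rfl⟩ := exists_comp_ιI_eq C hC hX g R R' x hR'
  rw [Category.assoc, Category.assoc, ιI_chart_invK, cls_comp_invJ, Category.assoc]

/-! ### The unit and the group structure -/

/-- A `K`-point of `W` (there is one as `W ≠ ∅`). [folklore] -/
def basePt : AlgPoints (WK C hC hX g) K := Classical.choice (exists_algPoint_WK C hC hX g hW)

/-- A tuple `R₀` with `Σ[R₀] = Ê(basePt)`. [folklore] -/
def baseTuple : Fin g → AlgPoints C K := (exists_tuplePt_mk_eq C g hC (basePt C hC hX g hW ≫ ιW C hC hX g)).choose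

omit [CharZero K] in
/-- `Σ[baseTuple]`, as a point of `C⁽ᵍ⁾`, is `basePt`. [folklore] -/
theorem tuplePt_baseTuple :
    tuplePt C (strPt (K := K) K) (baseTuple C hC hX g hW) ≫ symPowProj.mk C hC g = basePt C hC hX g hW ≫ ιW C hC hX g :=
  (exists_tuplePt_mk_eq C g hC (basePt C hC hX g hW ≫ ιW C hC hX g)).choose_spec

/-- **The unit `K`-point `0 = [E₀ − Ê(E₀)]` of `J`.** [cite: Milne1986JacobianVarieties, §7 Thm. 7.1 (proof)] -/
def onePt : AlgPoints (JK C hC hX g hg) K := basePt C hC hX g hW ≫ chart C hC hX g hg (baseTuple C hC hX g hW)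

/-- `cls 0 = 0`. [folklore] -/
theorem cls_onePt : cls C hC hX g hg (onePt C hC hX g hg hW) = 0 := by
  rw [onePt, cls_comp_chart, ← tuplePt_baseTuple, liftDiv_tuplePt_mk, sub_self]
  rfl

/-- **The unit `e : Spec K → J`.** [cite: Milne1986JacobianVarieties, §7 Thm. 7.1 (proof)] -/
def oneK : 𝟙_ (SchemeOver K) ⟶ JK C hC hX g hg := unitToSpecOver K ≫ onePt C hC hX g hg hW

/-- `toUnit ≫ e = 0`. [folklore] -/
theorem toUnit_oneK : toUnit (specOver K K) ≫ oneK C hC hX g hg hW = onePt C hC hX g hg hW := by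
  rw [oneK, ← Category.assoc, toUnit_unitToSpecOver, Category.id_comp]

/-- **The group-scheme structure on `J`**: the morphisms `m`, `e`, `inv` satisfy the group axioms
because `cls : J(K) ↪ Pic(C)` is injective and carries them to `+`, `0`, `−`
(`GrpObj.ofAlgPointsOfInjective`). [cite: Milne1986JacobianVarieties, §7 Thm. 7.1 (proof)] -/
@[implicit_reducible]
def grpObj : GrpObj (JK C hC hX g hg) :=
  haveI := geometricallyIntegral_JK_hom C hC hX g hg (baseTuple C hC hX g hW) hW
  GrpObj.ofAlgPointsOfInjective (Ω := K) (mul := mK C hC hX g hg hW) (one := oneK C hC hX g hg hW)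
    (inv := invK C hC hX g hg hW) (cls C hC hX g hg) (cls_injective C hC hX g hg) (cls_mul C hC hX g hg hW)
    (by rw [toUnit_oneK, cls_onePt]) (cls_inv C hC hX g hg hW)

/-- **Weil's Jacobian `J` of `C` as an abelian variety over `K`.** [cite: Milne1986JacobianVarieties, §7 Thm. 7.1] -/
def Jac : AbelianVariety K where
  X := JK C hC hX g hg
  grpObj := grpObj C hC hX g hg hW
  isProper := isProper_JK_hom C hC hX g hg (baseTuple C hC hX g hW) hW
  geometricallyIntegral := geometricallyIntegral_JK_hom C hC hX g hg (baseTuple C hC hX g hW) hW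

/-- The multiplication of `Jac` is `mK`. [folklore] -/
theorem Jac_mul : (Jac C hC hX g hg hW).grpObj.mul = mK C hC hX g hg hW := rfl

/-- The unit of `Jac` is `oneK`. [folklore] -/
theorem Jac_one : (Jac C hC hX g hg hW).grpObj.one = oneK C hC hX g hg hW := rfl

/-- The inverse of `Jac` is `invK`. [folklore] -/
theorem Jac_inv : (Jac C hC hX g hg hW).grpObj.inv = invK C hC hX g hg hW := rfl

end WeilJacobian

end Literature.AlgebraicGeometry.Motives

end
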